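/-
Copyright: the b2b-balaban T⁴-continuum CRUX team, row NE7b OWNER lineage `t4-ne7b-p1` (gen 125). Project licence.
-/
import Summits.QuantumFields.BalabanUV.T4Continuum.Spine.NE7b.SupZdCoarseInverse

/-!
# KERNEL ALGEBRA ON `ℤ^d`, VI: THE `ℓ²` FORM OF A DECAYING RIGHT INVERSE — for a kernel `T` with exponentially decaying entries, a FLOOR
# `γΣ_S g² ≤ ⟨g, Tg⟩_S` and a FORM BOUND `⟨h, Tg⟩_S² ≤ Λ²‖h‖²‖g‖²` on finitely supported functions, and ANY exponentially decaying kernel `N`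
# with `TN = 1` (rows): for every finitely supported `k`, `Nk` is square-summable, `‖Nk‖₂ ≤ γ⁻¹‖k‖₂`, `γ‖Nk‖₂² ≤ ⟨k, Nk⟩ ≤ γ⁻¹‖k‖₂²` and
# `⟨k, Nk⟩ ≥ (γ∕Λ²)‖k‖₂²` — (205)'s four form bounds for `M = T_∞⁻¹`, stated ONCE for every decaying right inverse and WITHOUT sections or
# symmetry: the floor and the form bound EXTEND from finite supports to exponentially localised functions by exhausting `ℤ^d` with the cubes
# `[−R, R]^d` (absolute convergence on `ℤ^d × ℤ^d`); the instance `T = T_K`, `N = N_K` of the `H + K` column is the sequel (row NE7b, node U5c;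
# (189)∕(191)∕(194) BY NAME; [folklore])

Cell `pub-balaban`, sub-cell `t4`, spine estimate NE7b (`T4WeightBudget.RelWeightBound`; the cell's OWN estimate — NOT PRINTED in
[Bałaban 1983–89], NOT PROVED).  Crux-route work under `Spine/NE7b/` by the row OWNER (`t4-ne7b-p1` gen 125, file (233)) under FREEZE
(0)'s crux-prover clause; NOTHING of Bałaban's is named as a Lean object, valued or asserted; no `T4Continuum/Support` leaf typed; no `def`,
no notation; zero `sorry`; no road object at all (pure kernel algebra on `ℤ^d`; the cubes `[−R, R]^d` WRITTEN OUT as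
`Fintype.piFinset fun _ => Finset.Icc (−R) R`).  Imports (BY NAME): the OWNER's (194) `…SupZdCoarseInverse` (`mem_cube_of_l1_le`, `cube_mono`,
`l1_triangle`; through it (191) `natAbs_sub_comm_sum`, (189) `summable_exp_l1`, `tsum_exp_l1_le`, `summable_kernel_row`), Mathlib's
`tendsto_atTop_finset_of_monotone`, `Summable.tsum_prod`, `summable_prod_of_nonneg`, `Summable.sum_le_tsum`, `Summable.tsum_finsetSum`,
`tsum_eq_sum`, `le_of_tendsto_of_tendsto'`, `le_of_tendsto`, `Finset.sum_mul_sq_le_sq_mul_sq`.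

WHY (located).  (205) proved that the infinite-volume next-scale action of the LINEAR column is strictly convex with a bounded Hessian by
passing (186)'s floor through the SECTION inverses `(T_{[−R,R]^d})⁻¹k → Mk`.  The `H + K` column's `N_K = T_K⁻¹` ((218)∕(219)∕(222)) was NOT
built from sections but by a Neumann series, so (205)'s route does not transfer by name; and the floor of a form says nothing directly about
functions of infinite support such as `N_Kk`.  The remedy is elementary and general: if `|m(b)| ≤ Ae^{−ν|b − b₀|₁}` then `b ↦ m(b)T(b,c)m(c)` is
absolutely summable on `ℤ^d × ℤ^d` (row decay of `T`), the cube truncations `m𝟙_{Q_R}` are finitely supported, the floor applies to them, and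
both sides converge along `R → ∞` (`Q_R × Q_R` exhausts `ℤ^d × ℤ^d`); likewise `⟨k, Tm⟩² ≤ Λ²‖k‖²‖m‖²` for finitely supported `k`.  With `m = Nk`
and `T(Nk) = k` (rows of `TN = 1`, finite sums through the series): `γ‖Nk‖² ≤ ⟨Nk, T(Nk)⟩ = ⟨k, Nk⟩ ≤ ‖k‖‖Nk‖` and `‖k‖² = ⟨k, T(Nk)⟩ ≤ Λ‖k‖‖Nk‖`
— the four bounds follow by arithmetic.  No symmetry of `T` or `N` and no left inverse is used.

WHAT IS PROVED ([folklore]; `X d = ℤ^d`, `Q_R = [−R, R]^d`, `|·|₁` the `ℓ¹` distance):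
* §1 `cube_tendsto`, **`tendsto_cube_sum`** (`Σ_{Q_R}f → Σ′f`), `cube_prod_tendsto`, **`tendsto_cube_double_sum`** (`Σ_{Q_R}Σ_{Q_R}F → Σ′Σ′F` for
  `F` absolutely summable on `ℤ^d × ℤ^d`).
* §2 `summable_sq_of_decay`; **`floor_of_decay`** (floor `γ` on finite supports ⟹ `γΣ′m² ≤ Σ′_b m(b)Σ′_c T(b,c)m(c)` for exponentially localised
  `m`, with all summabilities); **`form_sq_le_of_decay`** (form bound `Λ` on finite supports ⟹ `(Σ_S k·Σ′_c T(·,c)m(c))² ≤ Λ²(Σ_S k²)(Σ′m²)`).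
* §3 THE END **`decaying_inverse_form`**: `T` (decay, floor `γ > 0`, form bound `Λ > 0`), `N` (decay, `TN = 1`), `k` vanishing off a finite `S`
  ⟹ with `Nk = Σ_{c ∈ S}N(·,c)k(c)`: `T(Nk) = k`; `Σ′(Nk)²` converges and dominates every `Σ_F(Nk)²`; (i) `Σ′(Nk)² ≤ γ⁻²Σ_Sk²`; (ii) `γΣ′(Nk)² ≤
  ⟨k, Nk⟩`; (iii) `⟨k, Nk⟩ ≤ γ⁻¹Σ_Sk²`; (iv) `(γ∕Λ²)Σ_Sk² ≤ ⟨k, Nk⟩`.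
* §4 toy.

HONEST (what this is NOT).  Abstract kernel algebra; the `ℓ²` OPERATOR (density, Lax–Milgram packaging) is not built; constants as given;
nothing of the torus; nothing of the covariant propagators of [B4]–[B6]; nothing of Bałaban's asserted.  BY-NAME EFFECT ON THE WALL: NONE.
NE7b NOT PRINTED ∕ NOT PROVED; spine PROVED 0∕9; rung (B)+1 — the programme's measures remain FINITE-torus statements; NOT the mass gap, NOT
Clay.  HONEST DEPENDENCY: continuum YM on T⁴ ⇐ BetaPertH ∧ nine spine estimates (0∕9 proved); BetaPertH ⇐ (D1) ∧ (D4) ∧ CAP+tail; G-an2-4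
gates asym, D1 and NE2∕3∕4.
-/

set_option autoImplicit false

noncomputable section

namespace Summit.QuantumFields.BalabanUV.T4Continuum.NE7b.SupZdKernelForm

open Real Filter Topology
open Literature.MathematicalPhysics.QuantumFieldTheory.Balaban1983to89
open B6QGQLower276 (X)
open SupZdExponentialSums (summable_exp_l1 tsum_exp_l1_le summable_kernel_row)
open SupZdCoarseForm (natAbs_sub_comm_sum)
open SupZdCoarseInverse (l1_triangle mem_cube_of_l1_le cube_mono)

variable {d : ℕ}

/-! ## §1. Sums over the cubes `[−R, R]^d` converge to the series -/

/-- The cubes `[−R, R]^d` exhaust `ℤ^d` monotonically: `R ↦ Q_R` tends to `atTop` in `Finset (ℤ^d)`. [folklore] -/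
theorem cube_tendsto :
    Tendsto (fun R : ℕ => (Fintype.piFinset fun _ : Fin d => Finset.Icc (-(R : ℤ)) R)) atTop atTop :=
  tendsto_atTop_finset_of_monotone (fun _ _ h => cube_mono h) fun b => ⟨∑ j, (b j).natAbs, mem_cube_of_l1_le _ b le_rfl⟩

/-- **CUBE SUMS CONVERGE TO THE SERIES**: `Σ_{b ∈ Q_R}f b → Σ′f` for a summable `f`. [folklore] -/
theorem tendsto_cube_sum {f : X d → ℝ} (hf : Summable f) :
    Tendsto (fun R : ℕ => ∑ b ∈ (Fintype.piFinset fun _ : Fin d => Finset.Icc (-(R : ℤ)) R), f b) atTop (𝓝 (∑' b, f b)) :=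
  hf.hasSum.comp cube_tendsto

/-- The product cubes `Q_R × Q_R` exhaust `ℤ^d × ℤ^d` monotonically. [folklore] -/
theorem cube_prod_tendsto :
    Tendsto (fun R : ℕ => (Fintype.piFinset fun _ : Fin d => Finset.Icc (-(R : ℤ)) R) ×ˢ
      (Fintype.piFinset fun _ : Fin d => Finset.Icc (-(R : ℤ)) R)) atTop atTop :=
  tendsto_atTop_finset_of_monotone (fun _ _ h => Finset.product_subset_product (cube_mono h) (cube_mono h))
    fun x => ⟨max (∑ j, (x.1 j).natAbs) (∑ j, (x.2 j).natAbs), Finset.mem_product.2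
      ⟨mem_cube_of_l1_le _ x.1 (le_max_left _ _), mem_cube_of_l1_le _ x.2 (le_max_right _ _)⟩⟩

/-- **DOUBLE CUBE SUMS CONVERGE TO THE ITERATED SERIES**: `Σ_{b ∈ Q_R}Σ_{c ∈ Q_R}F(b,c) → Σ′_bΣ′_cF(b,c)` for `F` absolutely summable on
`ℤ^d × ℤ^d`. [folklore] -/
theorem tendsto_cube_double_sum {F : X d → X d → ℝ} (hF : Summable (Function.uncurry F)) :
    Tendsto (fun R : ℕ => ∑ b ∈ (Fintype.piFinset fun _ : Fin d => Finset.Icc (-(R : ℤ)) R),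
      ∑ c ∈ (Fintype.piFinset fun _ : Fin d => Finset.Icc (-(R : ℤ)) R), F b c) atTop (𝓝 (∑' b, ∑' c, F b c)) := by
  have h : Tendsto (fun R : ℕ => ∑ x ∈ (Fintype.piFinset fun _ : Fin d => Finset.Icc (-(R : ℤ)) R) ×ˢ
      (Fintype.piFinset fun _ : Fin d => Finset.Icc (-(R : ℤ)) R), Function.uncurry F x) atTop
      (𝓝 (∑' x, Function.uncurry F x)) := hF.hasSum.comp cube_prod_tendsto
  rw [hF.tsum_prod] at h
  have e : (fun R : ℕ => ∑ x ∈ (Fintype.piFinset fun _ : Fin d => Finset.Icc (-(R : ℤ)) R) ×ˢ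
      (Fintype.piFinset fun _ : Fin d => Finset.Icc (-(R : ℤ)) R), Function.uncurry F x)
      = fun R : ℕ => ∑ b ∈ (Fintype.piFinset fun _ : Fin d => Finset.Icc (-(R : ℤ)) R),
          ∑ c ∈ (Fintype.piFinset fun _ : Fin d => Finset.Icc (-(R : ℤ)) R), F b c :=
    funext fun R => by rw [Finset.sum_product]; rfl
  rw [e] at h
  exact h

/-! ## §2. The floor and the form bound extend from finite supports to exponentially localised functions -/

/-- An exponentially localised function is bounded by its constant and square-summable. [folklore] -/
theorem summable_sq_of_decay {A ν : ℝ} (hν : 0 < ν) (b₀ : X d) (m : X d → ℝ)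
    (hm : ∀ b, |m b| ≤ A * exp (-(ν * ∑ i, (((b i - b₀ i).natAbs : ℕ) : ℝ)))) :
    0 ≤ A ∧ (∀ b, |m b| ≤ A) ∧ Summable (fun b => m b ^ 2) := by
  have hA : 0 ≤ A := by
    have h := (abs_nonneg _).trans (hm b₀)
    exact le_of_mul_le_mul_right (by rw [zero_mul]; exact h) (exp_pos _)
  have hE : ∀ b : X d, exp (-(ν * ∑ i, (((b i - b₀ i).natAbs : ℕ) : ℝ))) ≤ 1 := fun b =>
    exp_le_one_iff.2 (by rw [neg_nonpos]; positivity)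
  have hmA : ∀ b, |m b| ≤ A := fun b => (hm b).trans (mul_le_of_le_one_right hA (hE b))
  refine ⟨hA, hmA, ?_⟩
  refine Summable.of_norm_bounded ((summable_exp_l1 hν b₀).mul_left (A ^ 2)) fun b => ?_
  rw [Real.norm_eq_abs, abs_of_nonneg (sq_nonneg _), natAbs_sub_comm_sum b₀ b]
  calc m b ^ 2 = |m b| * |m b| := by rw [← sq_abs, sq]
    _ ≤ A * (A * exp (-(ν * ∑ i, (((b i - b₀ i).natAbs : ℕ) : ℝ)))) := mul_le_mul (hmA b) (hm b) (abs_nonneg _) hA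
    _ = _ := by ring

/-- **THE FLOOR EXTENDS TO EXPONENTIALLY LOCALISED FUNCTIONS**: a kernel `|T(b,c)| ≤ C_Te^{−δ_T|b−c|₁}` whose form has the floor
`γΣ_{b ∈ S}g b² ≤ Σ_{b ∈ S}g b·Σ_{c ∈ S}T(b,c)g c` for every `g` vanishing off a finite `S`, and a function `|m(b)| ≤ Ae^{−ν|b−b₀|₁}` ⟹ `Σ′m²`
and every `Σ′_cT(b,c)m(c)` converge, `b ↦ m(b)Σ′_cT(b,c)m(c)` is summable, and `γΣ′m² ≤ Σ′_b m(b)·Σ′_cT(b,c)m(c)` — the floor on the cube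
truncations `m𝟙_{Q_R}` and the limit `R → ∞` (absolute convergence of `m(b)T(b,c)m(c)` on `ℤ^d × ℤ^d`). [folklore] -/
theorem floor_of_decay {CT δT γ A ν : ℝ} (hδT : 0 < δT) (hν : 0 < ν) (T : X d → X d → ℝ)
    (hT : ∀ b c, |T b c| ≤ CT * exp (-(δT * ∑ i, (((b i - c i).natAbs : ℕ) : ℝ))))
    (hfloor : ∀ (S : Finset (X d)) (g : X d → ℝ), (∀ b, b ∉ S → g b = 0) →
      γ * ∑ b ∈ S, g b ^ 2 ≤ ∑ b ∈ S, g b * ∑ c ∈ S, T b c * g c)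
    (b₀ : X d) (m : X d → ℝ) (hm : ∀ b, |m b| ≤ A * exp (-(ν * ∑ i, (((b i - b₀ i).natAbs : ℕ) : ℝ)))) :
    Summable (fun b => m b ^ 2) ∧ (∀ b, Summable (fun c => T b c * m c)) ∧
    Summable (fun b => m b * ∑' c, T b c * m c) ∧
    γ * ∑' b, m b ^ 2 ≤ ∑' b, m b * ∑' c, T b c * m c := by
  classical
  obtain ⟨hA, hmA, hsq⟩ := summable_sq_of_decay hν b₀ m hm
  have hCT : 0 ≤ CT := by
    have h := (abs_nonneg _).trans (hT b₀ b₀)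
    exact le_of_mul_le_mul_right (by rw [zero_mul]; exact h) (exp_pos _)
  have hrow : ∀ b, Summable (fun c => T b c * m c) := fun b => summable_kernel_row hδT T hT m hmA b
  -- the dominating family on `ℤ^d × ℤ^d`
  obtain ⟨G, hG⟩ : ∃ G : X d × X d → ℝ, ∀ x, G x = (A * exp (-(ν * ∑ i, (((b₀ i - x.1 i).natAbs : ℕ) : ℝ))))
      * ((CT * A) * exp (-(δT * ∑ i, (((x.1 i - x.2 i).natAbs : ℕ) : ℝ)))) := ⟨_, fun _ => rfl⟩
  have hG0 : 0 ≤ G := fun x => by rw [hG]; positivity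
  have hGs : Summable G := by
    refine (summable_prod_of_nonneg hG0).2 ⟨fun b => ?_, ?_⟩
    · refine ((summable_exp_l1 hδT b).mul_left (A * exp (-(ν * ∑ i, (((b₀ i - b i).natAbs : ℕ) : ℝ))) * (CT * A))).congr
        fun c => ?_
      rw [hG]; ring
    · have e : ∀ b : X d, ∑' c, G (b, c) = A * exp (-(ν * ∑ i, (((b₀ i - b i).natAbs : ℕ) : ℝ))) * (CT * A)
          * ∑' c : X d, exp (-(δT * ∑ i, (((b i - c i).natAbs : ℕ) : ℝ))) := fun b => by
        rw [← tsum_mul_left]; exact tsum_congr fun c => by rw [hG]; ring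
      refine Summable.of_nonneg_of_le (fun b => tsum_nonneg fun c => hG0 (b, c)) (fun b => ?_)
        ((summable_exp_l1 hν b₀).mul_left (A * (CT * A) * (2 * (1 - exp (-δT))⁻¹) ^ d))
      rw [e b]
      calc A * exp (-(ν * ∑ i, (((b₀ i - b i).natAbs : ℕ) : ℝ))) * (CT * A)
            * ∑' c : X d, exp (-(δT * ∑ i, (((b i - c i).natAbs : ℕ) : ℝ)))
          ≤ A * exp (-(ν * ∑ i, (((b₀ i - b i).natAbs : ℕ) : ℝ))) * (CT * A) * (2 * (1 - exp (-δT))⁻¹) ^ d :=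
            mul_le_mul_of_nonneg_left (tsum_exp_l1_le hδT b) (by positivity)
        _ = _ := by ring
  have hprod : Summable (fun x : X d × X d => m x.1 * (T x.1 x.2 * m x.2)) := by
    refine Summable.of_norm_bounded hGs fun x => ?_
    rw [Real.norm_eq_abs, abs_mul, abs_mul, hG]
    have h1 : |m x.1| ≤ A * exp (-(ν * ∑ i, (((b₀ i - x.1 i).natAbs : ℕ) : ℝ))) := by
      rw [natAbs_sub_comm_sum]; exact hm x.1
    have h2 : |T x.1 x.2| * |m x.2| ≤ (CT * A) * exp (-(δT * ∑ i, (((x.1 i - x.2 i).natAbs : ℕ) : ℝ))) :=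
      calc |T x.1 x.2| * |m x.2| ≤ CT * exp (-(δT * ∑ i, (((x.1 i - x.2 i).natAbs : ℕ) : ℝ))) * A :=
            mul_le_mul (hT _ _) (hmA _) (abs_nonneg _) (by positivity)
        _ = _ := by ring
    exact mul_le_mul h1 h2 (by positivity) (by positivity)
  -- the floor on the cube truncations
  have hR : ∀ R : ℕ, γ * ∑ b ∈ (Fintype.piFinset fun _ : Fin d => Finset.Icc (-(R : ℤ)) R), m b ^ 2
      ≤ ∑ b ∈ (Fintype.piFinset fun _ : Fin d => Finset.Icc (-(R : ℤ)) R),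
          ∑ c ∈ (Fintype.piFinset fun _ : Fin d => Finset.Icc (-(R : ℤ)) R), m b * (T b c * m c) := by
    intro R
    have h := hfloor (Fintype.piFinset fun _ : Fin d => Finset.Icc (-(R : ℤ)) R)
      (fun b => if b ∈ (Fintype.piFinset fun _ : Fin d => Finset.Icc (-(R : ℤ)) R) then m b else 0) (fun b hb => if_neg hb)
    have e1 : ∑ b ∈ (Fintype.piFinset fun _ : Fin d => Finset.Icc (-(R : ℤ)) R),
        (if b ∈ (Fintype.piFinset fun _ : Fin d => Finset.Icc (-(R : ℤ)) R) then m b else 0) ^ 2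
        = ∑ b ∈ (Fintype.piFinset fun _ : Fin d => Finset.Icc (-(R : ℤ)) R), m b ^ 2 :=
      Finset.sum_congr rfl fun b hb => by rw [if_pos hb]
    have e2 : ∑ b ∈ (Fintype.piFinset fun _ : Fin d => Finset.Icc (-(R : ℤ)) R),
        (if b ∈ (Fintype.piFinset fun _ : Fin d => Finset.Icc (-(R : ℤ)) R) then m b else 0)
          * ∑ c ∈ (Fintype.piFinset fun _ : Fin d => Finset.Icc (-(R : ℤ)) R),
            T b c * (if c ∈ (Fintype.piFinset fun _ : Fin d => Finset.Icc (-(R : ℤ)) R) then m c else 0)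
        = ∑ b ∈ (Fintype.piFinset fun _ : Fin d => Finset.Icc (-(R : ℤ)) R),
          ∑ c ∈ (Fintype.piFinset fun _ : Fin d => Finset.Icc (-(R : ℤ)) R), m b * (T b c * m c) :=
      Finset.sum_congr rfl fun b hb => by
        rw [if_pos hb, Finset.mul_sum]
        exact Finset.sum_congr rfl fun c hc => by rw [if_pos hc]
    rw [e1, e2] at h
    exact h
  -- the limit `R → ∞`
  have hlim1 : Tendsto (fun R : ℕ => γ * ∑ b ∈ (Fintype.piFinset fun _ : Fin d => Finset.Icc (-(R : ℤ)) R), m b ^ 2)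
      atTop (𝓝 (γ * ∑' b, m b ^ 2)) := (tendsto_cube_sum hsq).const_mul γ
  have hlim2 : Tendsto (fun R : ℕ => ∑ b ∈ (Fintype.piFinset fun _ : Fin d => Finset.Icc (-(R : ℤ)) R),
      ∑ c ∈ (Fintype.piFinset fun _ : Fin d => Finset.Icc (-(R : ℤ)) R), m b * (T b c * m c)) atTop
      (𝓝 (∑' b, ∑' c, m b * (T b c * m c))) :=
    tendsto_cube_double_sum (F := fun b c => m b * (T b c * m c)) hprod
  have hle := le_of_tendsto_of_tendsto' hlim1 hlim2 hR
  have e3 : (fun b => ∑' c, m b * (T b c * m c)) = fun b => m b * ∑' c, T b c * m c := funext fun b => tsum_mul_left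
  rw [e3] at hle
  refine ⟨hsq, hrow, ?_, hle⟩
  have h := hprod.prod
  rw [show (fun b => ∑' c, (fun x : X d × X d => m x.1 * (T x.1 x.2 * m x.2)) (b, c)) = fun b => ∑' c, m b * (T b c * m c)
    from rfl, e3] at h
  exact h

/-- **THE FORM BOUND EXTENDS**: a kernel with decaying rows and the form bound `(Σ_S h·Σ_S T g)² ≤ Λ²(Σ_S h²)(Σ_S g²)` on every finite `S`,
a function `|m(b)| ≤ Ae^{−ν|b−b₀|₁}` and `k` vanishing off a finite `S` ⟹ `(Σ_{b ∈ S}k b·Σ′_cT(b,c)m(c))² ≤ Λ²(Σ_Sk²)(Σ′m²)` — the bound on the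
cubes `Q_R ⊇ S` and the limit of the finitely many rows. [folklore] -/
theorem form_sq_le_of_decay {CT δT Λ A ν : ℝ} (hδT : 0 < δT) (hν : 0 < ν) (T : X d → X d → ℝ)
    (hT : ∀ b c, |T b c| ≤ CT * exp (-(δT * ∑ i, (((b i - c i).natAbs : ℕ) : ℝ))))
    (hform : ∀ (S : Finset (X d)) (g h : X d → ℝ),
      (∑ b ∈ S, h b * ∑ c ∈ S, T b c * g c) ^ 2 ≤ Λ ^ 2 * (∑ b ∈ S, h b ^ 2) * ∑ c ∈ S, g c ^ 2)
    (b₀ : X d) (m : X d → ℝ) (hm : ∀ b, |m b| ≤ A * exp (-(ν * ∑ i, (((b i - b₀ i).natAbs : ℕ) : ℝ))))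
    (S : Finset (X d)) (k : X d → ℝ) (hk : ∀ b, b ∉ S → k b = 0) :
    (∑ b ∈ S, k b * ∑' c, T b c * m c) ^ 2 ≤ Λ ^ 2 * (∑ b ∈ S, k b ^ 2) * ∑' c, m c ^ 2 := by
  classical
  obtain ⟨-, hmA, hsq⟩ := summable_sq_of_decay hν b₀ m hm
  have hrow : ∀ b, Summable (fun c => T b c * m c) := fun b => summable_kernel_row hδT T hT m hmA b
  -- `S ⊆ Q_R` for `R ≥ R₀`
  obtain ⟨R₀, hR₀⟩ : ∃ R₀ : ℕ, ∀ R : ℕ, R₀ ≤ R → S ⊆ Fintype.piFinset fun _ : Fin d => Finset.Icc (-(R : ℤ)) R :=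
    ⟨S.sup fun b => ∑ j, (b j).natAbs, fun R hR b hb =>
      cube_mono hR (mem_cube_of_l1_le _ b (Finset.le_sup (f := fun b : X d => ∑ j, (b j).natAbs) hb))⟩
  have hP : Tendsto (fun R : ℕ => ∑ b ∈ S, k b * ∑ c ∈ (Fintype.piFinset fun _ : Fin d => Finset.Icc (-(R : ℤ)) R), T b c * m c)
      atTop (𝓝 (∑ b ∈ S, k b * ∑' c, T b c * m c)) :=
    tendsto_finsetSum S fun b _ => (tendsto_cube_sum (hrow b)).const_mul (k b)
  refine le_of_tendsto (hP.pow 2) (Filter.eventually_atTop.2 ⟨R₀, fun R hR => ?_⟩)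
  have hSQ := hR₀ R hR
  have h1 := hform (Fintype.piFinset fun _ : Fin d => Finset.Icc (-(R : ℤ)) R) m k
  have e1 : ∑ b ∈ (Fintype.piFinset fun _ : Fin d => Finset.Icc (-(R : ℤ)) R),
      k b * ∑ c ∈ (Fintype.piFinset fun _ : Fin d => Finset.Icc (-(R : ℤ)) R), T b c * m c
      = ∑ b ∈ S, k b * ∑ c ∈ (Fintype.piFinset fun _ : Fin d => Finset.Icc (-(R : ℤ)) R), T b c * m c :=
    (Finset.sum_subset hSQ fun b _ hb => by rw [hk b hb, zero_mul]).symm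
  have e2 : ∑ b ∈ (Fintype.piFinset fun _ : Fin d => Finset.Icc (-(R : ℤ)) R), k b ^ 2 = ∑ b ∈ S, k b ^ 2 :=
    (Finset.sum_subset hSQ fun b _ hb => by rw [hk b hb]; ring).symm
  rw [e1, e2] at h1
  have h2 : ∑ c ∈ (Fintype.piFinset fun _ : Fin d => Finset.Icc (-(R : ℤ)) R), m c ^ 2 ≤ ∑' c, m c ^ 2 :=
    hsq.sum_le_tsum _ fun c _ => sq_nonneg _
  exact h1.trans (mul_le_mul_of_nonneg_left h2 (mul_nonneg (sq_nonneg _) (Finset.sum_nonneg fun _ _ => sq_nonneg _)))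

/-! ## §3. THE END: the `ℓ²` form of a decaying right inverse -/

/-- **HEADLINE — THE `ℓ²` FORM OF A DECAYING RIGHT INVERSE.**  Let `T` be a kernel on `ℤ^d` with `|T(b,c)| ≤ C_Te^{−δ_T|b−c|₁}`, whose form on
finitely supported functions has the FLOOR `γΣ_Sg² ≤ ⟨g, Tg⟩_S` (`γ > 0`) and the BOUND `⟨h, Tg⟩_S² ≤ Λ²(Σ_Sh²)(Σ_Sg²)` (`Λ > 0`); let `N` be ANY
kernel with `|N(b,c)| ≤ C_Ne^{−ν|b−c|₁}` and `Σ′_{b′}T(b,b′)N(b′,c) = δ_{bc}`.  Then for every `k` vanishing off a finite `S`, with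
`Nk = Σ_{c ∈ S}N(·,c)k(c)`: `Σ′_cT(b,c)(Nk)(c) = k(b)`; `Σ′(Nk)²` converges and dominates every `Σ_F(Nk)²`; (i) `Σ′(Nk)² ≤ γ⁻²Σ_Sk²`;
(ii) `γΣ′(Nk)² ≤ ⟨k, Nk⟩`; (iii) `⟨k, Nk⟩ ≤ γ⁻¹Σ_Sk²`; (iv) `(γ∕Λ²)Σ_Sk² ≤ ⟨k, Nk⟩` — §2 at `m = Nk`, `T(Nk) = k`, and Cauchy–Schwarz.  No
symmetry, no sections, no left inverse. [folklore] -/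
theorem decaying_inverse_form {CT δT γ Λ CN ν : ℝ} (hδT : 0 < δT) (hγ : 0 < γ) (hΛ : 0 < Λ) (hCN : 0 ≤ CN) (hν : 0 < ν)
    (T N : X d → X d → ℝ)
    (hT : ∀ b c, |T b c| ≤ CT * exp (-(δT * ∑ i, (((b i - c i).natAbs : ℕ) : ℝ))))
    (hfloor : ∀ (S : Finset (X d)) (g : X d → ℝ), (∀ b, b ∉ S → g b = 0) →
      γ * ∑ b ∈ S, g b ^ 2 ≤ ∑ b ∈ S, g b * ∑ c ∈ S, T b c * g c)
    (hform : ∀ (S : Finset (X d)) (g h : X d → ℝ),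
      (∑ b ∈ S, h b * ∑ c ∈ S, T b c * g c) ^ 2 ≤ Λ ^ 2 * (∑ b ∈ S, h b ^ 2) * ∑ c ∈ S, g c ^ 2)
    (hN : ∀ b c, |N b c| ≤ CN * exp (-(ν * ∑ i, (((b i - c i).natAbs : ℕ) : ℝ))))
    (hTN : ∀ b c, ∑' b' : X d, T b b' * N b' c = if b = c then 1 else 0)
    (S : Finset (X d)) (k : X d → ℝ) (hk : ∀ b, b ∉ S → k b = 0) :
    (∀ b, ∑' c, T b c * ∑ c' ∈ S, N c c' * k c' = k b) ∧
    Summable (fun b => (∑ c ∈ S, N b c * k c) ^ 2) ∧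
    (∀ F : Finset (X d), ∑ b ∈ F, (∑ c ∈ S, N b c * k c) ^ 2 ≤ ∑' b, (∑ c ∈ S, N b c * k c) ^ 2) ∧
    (∑' b, (∑ c ∈ S, N b c * k c) ^ 2 ≤ (1 / γ) ^ 2 * ∑ b ∈ S, k b ^ 2) ∧
    (γ * ∑' b, (∑ c ∈ S, N b c * k c) ^ 2 ≤ ∑ b ∈ S, k b * ∑ c ∈ S, N b c * k c) ∧
    (∑ b ∈ S, k b * ∑ c ∈ S, N b c * k c ≤ 1 / γ * ∑ b ∈ S, k b ^ 2) ∧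
    (γ / Λ ^ 2 * ∑ b ∈ S, k b ^ 2 ≤ ∑ b ∈ S, k b * ∑ c ∈ S, N b c * k c) := by
  classical
  obtain ⟨m, hm⟩ : ∃ m : X d → ℝ, ∀ b, m b = ∑ c ∈ S, N b c * k c := ⟨_, fun _ => rfl⟩
  have em : ∀ b, ∑ c ∈ S, N b c * k c = m b := fun b => (hm b).symm
  simp only [em]
  have hCT : 0 ≤ CT := by
    have h := (abs_nonneg _).trans (hT 0 0)
    exact le_of_mul_le_mul_right (by rw [zero_mul]; exact h) (exp_pos _)
  -- `m = Nk` is exponentially localised about the origin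
  have hmd : ∀ b, |m b| ≤ (CN * ∑ c ∈ S, exp (ν * ∑ i, (((c i - (0 : X d) i).natAbs : ℕ) : ℝ)) * |k c|)
      * exp (-(ν * ∑ i, (((b i - (0 : X d) i).natAbs : ℕ) : ℝ))) := by
    intro b
    rw [hm b, mul_assoc, Finset.sum_mul, Finset.mul_sum]
    refine (Finset.abs_sum_le_sum_abs _ _).trans (Finset.sum_le_sum fun c _ => ?_)
    rw [abs_mul]
    have htri := l1_triangle b c (0 : X d)
    have h1 : exp (-(ν * ∑ i, (((b i - c i).natAbs : ℕ) : ℝ)))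
        ≤ exp (ν * ∑ i, (((c i - (0 : X d) i).natAbs : ℕ) : ℝ)) * exp (-(ν * ∑ i, (((b i - (0 : X d) i).natAbs : ℕ) : ℝ))) := by
      rw [← exp_add]; exact exp_le_exp.2 (by nlinarith)
    calc |N b c| * |k c| ≤ CN * exp (-(ν * ∑ i, (((b i - c i).natAbs : ℕ) : ℝ))) * |k c| :=
          mul_le_mul_of_nonneg_right (hN b c) (abs_nonneg _)
      _ ≤ CN * (exp (ν * ∑ i, (((c i - (0 : X d) i).natAbs : ℕ) : ℝ))
            * exp (-(ν * ∑ i, (((b i - (0 : X d) i).natAbs : ℕ) : ℝ)))) * |k c| :=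
          mul_le_mul_of_nonneg_right (mul_le_mul_of_nonneg_left h1 hCN) (abs_nonneg _)
      _ = _ := by ring
  obtain ⟨hsq, hrow, -, hfl⟩ := floor_of_decay hδT hν T hT hfloor 0 m hmd
  obtain ⟨-, -, -⟩ := summable_sq_of_decay hν 0 m hmd
  -- `T(Nk) = k`
  have hNb : ∀ c', ∀ c, |N c c'| ≤ CN := fun c' c =>
    (hN c c').trans (mul_le_of_le_one_right hCN (exp_le_one_iff.2 (by rw [neg_nonpos]; positivity)))
  have hTm : ∀ b, ∑' c, T b c * m c = k b := by
    intro b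
    have e1 : ∀ c, T b c * m c = ∑ c' ∈ S, T b c * N c c' * k c' := fun c => by
      rw [hm c, Finset.mul_sum]; exact Finset.sum_congr rfl fun c' _ => by ring
    rw [tsum_congr e1, Summable.tsum_finsetSum (fun c' _ => (summable_kernel_row hδT T hT (fun c => N c c') (hNb c') b).mul_right _)]
    have e2 : ∀ c' ∈ S, ∑' c, T b c * N c c' * k c' = if b = c' then k c' else 0 := fun c' _ => by
      rw [tsum_mul_right, hTN b c']; split_ifs <;> simp
    rw [Finset.sum_congr rfl e2, Finset.sum_ite_eq]
    by_cases hb : b ∈ S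
    · rw [if_pos hb]
    · rw [if_neg hb, hk b hb]
  -- `⟨Nk, T(Nk)⟩ = ⟨k, Nk⟩`
  have hP : ∑' b, m b * ∑' c, T b c * m c = ∑ b ∈ S, k b * m b := by
    rw [tsum_congr (fun b => by rw [hTm b]), tsum_eq_sum (s := S) (fun b hb => by rw [hk b hb, mul_zero])]
    exact Finset.sum_congr rfl fun b _ => mul_comm _ _
  rw [hP] at hfl
  -- Cauchy–Schwarz and arithmetic
  have hX0 : 0 ≤ ∑' b, m b ^ 2 := tsum_nonneg fun _ => sq_nonneg _
  have hK0 : 0 ≤ ∑ b ∈ S, k b ^ 2 := Finset.sum_nonneg fun _ _ => sq_nonneg _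
  have hF : ∀ F : Finset (X d), ∑ b ∈ F, m b ^ 2 ≤ ∑' b, m b ^ 2 := fun F => hsq.sum_le_tsum F fun _ _ => sq_nonneg _
  have hCS : (∑ b ∈ S, k b * m b) ^ 2 ≤ (∑ b ∈ S, k b ^ 2) * ∑' b, m b ^ 2 :=
    (Finset.sum_mul_sq_le_sq_mul_sq S k m).trans (mul_le_mul_of_nonneg_left (hF S) hK0)
  have hP0 : 0 ≤ ∑ b ∈ S, k b * m b := le_trans (mul_nonneg hγ.le hX0) hfl
  -- (iii)
  have hiii : ∑ b ∈ S, k b * m b ≤ 1 / γ * ∑ b ∈ S, k b ^ 2 := by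
    rw [one_div_mul_eq_div, le_div_iff₀ hγ]
    rcases hP0.lt_or_eq with hpos | hzero
    · refine le_of_mul_le_mul_right ?_ hpos
      calc (∑ b ∈ S, k b * m b) * γ * ∑ b ∈ S, k b * m b = γ * (∑ b ∈ S, k b * m b) ^ 2 := by ring
        _ ≤ γ * ((∑ b ∈ S, k b ^ 2) * ∑' b, m b ^ 2) := mul_le_mul_of_nonneg_left hCS hγ.le
        _ = (∑ b ∈ S, k b ^ 2) * (γ * ∑' b, m b ^ 2) := by ring
        _ ≤ (∑ b ∈ S, k b ^ 2) * ∑ b ∈ S, k b * m b := mul_le_mul_of_nonneg_left hfl hK0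
    · rw [← hzero, zero_mul]; exact hK0
  -- (i)
  have hi : ∑' b, m b ^ 2 ≤ (1 / γ) ^ 2 * ∑ b ∈ S, k b ^ 2 := by
    rw [one_div_pow, one_div_mul_eq_div, le_div_iff₀ (pow_pos hγ 2)]
    rcases hX0.lt_or_eq with hpos | hzero
    · refine le_of_mul_le_mul_right ?_ hpos
      calc (∑' b, m b ^ 2) * γ ^ 2 * ∑' b, m b ^ 2 = (γ * ∑' b, m b ^ 2) ^ 2 := by ring
        _ ≤ (∑ b ∈ S, k b * m b) ^ 2 := pow_le_pow_left₀ (mul_nonneg hγ.le hX0) hfl 2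
        _ ≤ (∑ b ∈ S, k b ^ 2) * ∑' b, m b ^ 2 := hCS
    · rw [← hzero, zero_mul]; exact hK0
  -- (iv)
  have hiv : γ / Λ ^ 2 * ∑ b ∈ S, k b ^ 2 ≤ ∑ b ∈ S, k b * m b := by
    have hsqk : (∑ b ∈ S, k b ^ 2) ^ 2 ≤ Λ ^ 2 * (∑ b ∈ S, k b ^ 2) * ∑' c, m c ^ 2 := by
      have h := form_sq_le_of_decay hδT hν T hT hform 0 m hmd S k hk
      have e : ∑ b ∈ S, k b * ∑' c, T b c * m c = ∑ b ∈ S, k b ^ 2 :=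
        Finset.sum_congr rfl fun b _ => by rw [hTm b, sq]
      rwa [e] at h
    have hk2 : ∑ b ∈ S, k b ^ 2 ≤ Λ ^ 2 * ∑' c, m c ^ 2 := by
      rcases hK0.lt_or_eq with hpos | hzero
      · refine le_of_mul_le_mul_right ?_ hpos
        calc (∑ b ∈ S, k b ^ 2) * ∑ b ∈ S, k b ^ 2 = (∑ b ∈ S, k b ^ 2) ^ 2 := by ring
          _ ≤ Λ ^ 2 * (∑ b ∈ S, k b ^ 2) * ∑' c, m c ^ 2 := hsqk
          _ = Λ ^ 2 * (∑' c, m c ^ 2) * ∑ b ∈ S, k b ^ 2 := by ring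
      · rw [← hzero]; positivity
    have hΛ2 : 0 < Λ ^ 2 := pow_pos hΛ 2
    calc γ / Λ ^ 2 * ∑ b ∈ S, k b ^ 2 ≤ γ / Λ ^ 2 * (Λ ^ 2 * ∑' c, m c ^ 2) :=
          mul_le_mul_of_nonneg_left hk2 (div_pos hγ hΛ2).le
      _ = γ * ∑' c, m c ^ 2 := by field_simp
      _ ≤ ∑ b ∈ S, k b * m b := hfl
  exact ⟨hTm, hsq, hF, hi, hfl, hiii, hiv⟩

/-! ## §4. Toy -/

/-- Toy (`d = 1`): the identity kernel `T = N = δ` (decay with any rate, floor `1`, form bound `1`) — for `k` supported in a finite `S`,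
`⟨k, Nk⟩ = Σ_Sk²` sits between `(1∕1²)Σ_Sk²` and `1⁻¹Σ_Sk²`. -/
example (S : Finset (X 1)) (k : X 1 → ℝ) (hk : ∀ b, b ∉ S → k b = 0) :
    1 / (1 : ℝ) ^ 2 * ∑ b ∈ S, k b ^ 2 ≤ ∑ b ∈ S, k b * ∑ c ∈ S, (if b = c then (1 : ℝ) else 0) * k c ∧
    ∑ b ∈ S, k b * ∑ c ∈ S, (if b = c then (1 : ℝ) else 0) * k c ≤ 1 / 1 * ∑ b ∈ S, k b ^ 2 := by
  classical
  have hδ : ∀ b c : X 1, |(if b = c then (1 : ℝ) else 0)| ≤ 1 * exp (-(1 * ∑ i, (((b i - c i).natAbs : ℕ) : ℝ))) := by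
    intro b c
    split_ifs with h
    · subst h; simp
    · rw [abs_zero]; positivity
  have hdiag : ∀ (S : Finset (X 1)) (g : X 1 → ℝ) (b : X 1), b ∈ S →
      ∑ c ∈ S, (if b = c then (1 : ℝ) else 0) * g c = g b := fun S g b hb => by
    simp only [ite_mul, one_mul, zero_mul, Finset.sum_ite_eq, if_pos hb]
  have hfloor : ∀ (S : Finset (X 1)) (g : X 1 → ℝ), (∀ b, b ∉ S → g b = 0) →
      (1 : ℝ) * ∑ b ∈ S, g b ^ 2 ≤ ∑ b ∈ S, g b * ∑ c ∈ S, (if b = c then (1 : ℝ) else 0) * g c := fun S g _ => by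
    rw [one_mul]; exact le_of_eq (Finset.sum_congr rfl fun b hb => by rw [hdiag S g b hb, sq])
  have hform : ∀ (S : Finset (X 1)) (g h : X 1 → ℝ),
      (∑ b ∈ S, h b * ∑ c ∈ S, (if b = c then (1 : ℝ) else 0) * g c) ^ 2 ≤ (1 : ℝ) ^ 2 * (∑ b ∈ S, h b ^ 2) * ∑ c ∈ S, g c ^ 2 :=
    fun S g h => by
      rw [Finset.sum_congr rfl fun b hb => by rw [hdiag S g b hb], one_pow, one_mul]
      exact Finset.sum_mul_sq_le_sq_mul_sq S h g
  have hTN : ∀ b c : X 1, ∑' b' : X 1, (if b = b' then (1 : ℝ) else 0) * (if b' = c then (1 : ℝ) else 0) = if b = c then 1 else 0 :=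
    fun b c => by
      rw [tsum_eq_single b (fun b' hb' => by rw [if_neg (fun h => hb' h.symm), zero_mul]), if_pos rfl, one_mul]
  obtain ⟨-, -, -, -, -, h3, h4⟩ := decaying_inverse_form (d := 1) one_pos one_pos one_pos zero_le_one one_pos
    (fun b c => if b = c then (1 : ℝ) else 0) (fun b c => if b = c then (1 : ℝ) else 0) hδ hfloor hform hδ hTN S k hk
  exact ⟨h4, h3⟩

end Summit.QuantumFields.BalabanUV.T4Continuum.NE7b.SupZdKernelForm
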